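import Literature.Analysis.SpecialFunctions.SelbergIntegral
import Mathlib.Analysis.SpecialFunctions.Gamma.Deriv
import HarnessLib

/-!
# Selberg's product: Gamma-function algebra

Algebraic facts about the right-hand side
`selbergProduct n a b c = ∏_{j<n} Γ(a+jc)Γ(b+jc)Γ(1+(j+1)c) / (Γ(a+b+(n+j-1)c)Γ(1+c))` of Selberg's
formula (`Literature.Analysis.SpecialFunctions.selberg_integral_formula`), used in the proof of
the formula along the lines of Aomoto's argument (G. E. Andrews, R. Askey, R. Roy,
*Special Functions* (1999), §8.2; P. J. Forrester, S. O. Warnaar, Bull. AMS 45 (2008), §1):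

* positivity of all the linear forms `a + jc`, `b + jc`, `1 + (j+1)c`, `a + b + (n+j-1)c`, `1 + c`
  on the Forrester–Warnaar domain (1.2), hence positivity of `selbergProduct`;
* the first-order recurrence in `a`:
  `selbergProduct n (a+1) b c = selbergProduct n a b c · ∏_{j<n} (a+jc)/(a+b+(n+j-1)c)`
  (the product side of Aomoto's recurrence, AAR (8.2.?)/Thm. 8.1.1 proof);
* Selberg's normalisation identity in the form of a limit:
  `a · selbergProduct (m+1) a b c → (m+1) · selbergProduct m (2c) b c` as `a → 0⁺` (`b, c > 0`).

Everything here is fully proved; no named facts.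
-/

noncomputable section

open Real Finset Filter Topology

namespace Literature.Analysis.SpecialFunctions

namespace Selberg

/-! ### Positivity of the linear forms on the domain (1.2) -/

/-- On the domain (1.2), `a + jc > 0` for `j < n`. [cite: ForresterWarnaar2008, eq. (1.2)] -/
theorem linForm_pos {a c : ℝ} {n j : ℕ} (ha : 0 < a) (hjn : j < n)
    (h : -a < ((n : ℝ) - 1) * c) : 0 < a + j * c := by
  rcases le_or_gt 0 c with hc | hc
  · positivity
  · have hj : (j : ℝ) ≤ n - 1 := by
      have : (j : ℝ) + 1 ≤ n := by exact_mod_cast hjn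
      linarith
    have : ((n : ℝ) - 1) * c ≤ j * c := mul_le_mul_of_nonpos_right hj hc.le
    linarith

/-- On the domain (1.2), `1 + (j+1)c > 0` for `j < n`. [cite: ForresterWarnaar2008, eq. (1.2)] -/
theorem one_add_linForm_pos {c : ℝ} {n j : ℕ} (hjn : j < n) (h : -(1 : ℝ) / n < c) :
    0 < 1 + ((j : ℝ) + 1) * c := by
  rcases le_or_gt 0 c with hc | hc
  · positivity
  · have hn : (0 : ℝ) < n := by
      have : ((j : ℝ) + 1) ≤ n := by exact_mod_cast hjn
      linarith [(by positivity : (0 : ℝ) ≤ j)]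
    have h1 : -1 < n * c := by
      have := (div_lt_iff₀ hn).1 h
      linarith [mul_comm c (n : ℝ)]
    have hj : ((j : ℝ) + 1) ≤ n := by exact_mod_cast hjn
    have : (n : ℝ) * c ≤ ((j : ℝ) + 1) * c := mul_le_mul_of_nonpos_right hj hc.le
    linarith

/-- On the domain (1.2), `1 + c > 0`. [cite: ForresterWarnaar2008, eq. (1.2)] -/
theorem one_add_pos {c : ℝ} {n : ℕ} (hn : 1 ≤ n) (h : -(1 : ℝ) / n < c) : 0 < 1 + c := by
  have := one_add_linForm_pos (j := 0) (n := n) (c := c) (by omega) h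
  simpa using this

/-- On the domain (1.2), `a + b + (n+j-1)c > 0` for `j < n`.
[cite: ForresterWarnaar2008, eq. (1.2)] -/
theorem sumForm_pos {a b c : ℝ} {n j : ℕ} (ha : 0 < a) (hb : 0 < b) (hjn : j < n)
    (ha' : -a < ((n : ℝ) - 1) * c) (hb' : -b < ((n : ℝ) - 1) * c) :
    0 < a + b + ((n : ℝ) + j - 1) * c := by
  have hn1 : (1 : ℝ) ≤ n := by
    have : ((j : ℝ) + 1) ≤ n := by exact_mod_cast hjn
    linarith [(by positivity : (0 : ℝ) ≤ j)]
  rcases le_or_gt 0 c with hc | hc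
  · have : 0 ≤ ((n : ℝ) + j - 1) * c := mul_nonneg (by linarith [(by positivity : (0 : ℝ) ≤ j)]) hc
    linarith
  · have hj : ((n : ℝ) + j - 1) ≤ 2 * ((n : ℝ) - 1) := by
      have : ((j : ℝ) + 1) ≤ n := by exact_mod_cast hjn
      linarith
    have : 2 * ((n : ℝ) - 1) * c ≤ ((n : ℝ) + j - 1) * c := by
      have := mul_le_mul_of_nonpos_right hj hc.le
      linarith
    linarith

/-- **Positivity of Selberg's product** on the domain (1.2): every Gamma factor has positive
argument. [cite: ForresterWarnaar2008, eq. (1.1)–(1.2)] -/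
theorem selbergProduct_pos {n : ℕ} {a b c : ℝ} (hn : 1 ≤ n) (ha : 0 < a) (hb : 0 < b)
    (hc : -(1 : ℝ) / n < c) (ha' : -a < ((n : ℝ) - 1) * c) (hb' : -b < ((n : ℝ) - 1) * c) :
    0 < selbergProduct n a b c := by
  unfold selbergProduct
  refine prod_pos fun j hj => ?_
  rw [Finset.mem_range] at hj
  refine div_pos (mul_pos (mul_pos ?_ ?_) ?_) (mul_pos ?_ ?_)
  · exact Gamma_pos_of_pos (linForm_pos ha hj ha')
  · exact Gamma_pos_of_pos (linForm_pos hb hj hb')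
  · exact Gamma_pos_of_pos (one_add_linForm_pos hj hc)
  · exact Gamma_pos_of_pos (sumForm_pos ha hb hj ha' hb')
  · exact Gamma_pos_of_pos (one_add_pos hn hc)

/-- In the positive-`c` regime the hypotheses of (1.2) beyond `a, b > 0` are automatic.
[cite: ForresterWarnaar2008, eq. (1.2)] -/
theorem selbergProduct_pos_of_nonneg {n : ℕ} {a b c : ℝ} (hn : 1 ≤ n) (ha : 0 < a) (hb : 0 < b)
    (hc : 0 ≤ c) : 0 < selbergProduct n a b c := by
  have hn' : (0 : ℝ) < n := by exact_mod_cast hn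
  have hn1 : (0 : ℝ) ≤ (n : ℝ) - 1 := by
    have : (1 : ℝ) ≤ n := by exact_mod_cast hn
    linarith
  refine selbergProduct_pos hn ha hb ?_ ?_ ?_
  · have : -(1 : ℝ) / n < 0 := by
      rw [neg_div]; exact neg_neg_of_pos (one_div_pos.2 hn')
    linarith
  · nlinarith
  · nlinarith

/-! ### The recurrence in `a` -/

/-- **The product side of Aomoto's recurrence**:
`selbergProduct n (a+1) b c = selbergProduct n a b c · ∏_{j<n} (a+jc)/(a+b+(n+j-1)c)`,
from `Γ(x+1) = xΓ(x)`, valid as soon as no `a + jc` or `a + b + (n+j-1)c` vanishes.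
[cite: ForresterWarnaar2008, eq. (1.1)] -/
theorem selbergProduct_add_one (n : ℕ) {a b c : ℝ} (h1 : ∀ j < n, a + j * c ≠ 0)
    (h2 : ∀ j < n, a + b + ((n : ℝ) + j - 1) * c ≠ 0) :
    selbergProduct n (a + 1) b c =
      selbergProduct n a b c * ∏ j ∈ range n, (a + j * c) / (a + b + ((n : ℝ) + j - 1) * c) := by
  unfold selbergProduct
  rw [← prod_mul_distrib]
  refine prod_congr rfl fun j hj => ?_
  rw [Finset.mem_range] at hj
  have e1 : a + 1 + j * c = (a + j * c) + 1 := by ring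
  have e2 : a + 1 + b + ((n : ℝ) + j - 1) * c = (a + b + ((n : ℝ) + j - 1) * c) + 1 := by ring
  rw [e1, e2, Gamma_add_one (h1 j hj), Gamma_add_one (h2 j hj), div_mul_div_comm]
  congr 1 <;> ring

/-- The recurrence in `a` on the positive domain: all side conditions hold for `a, b > 0`,
`c ≥ 0`. [cite: ForresterWarnaar2008, eq. (1.1)] -/
theorem selbergProduct_add_one_of_nonneg (n : ℕ) {a b c : ℝ} (ha : 0 < a) (hb : 0 < b)
    (hc : 0 ≤ c) :
    selbergProduct n (a + 1) b c =
      selbergProduct n a b c * ∏ j ∈ range n, (a + j * c) / (a + b + ((n : ℝ) + j - 1) * c) := by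
  refine selbergProduct_add_one n (fun j _ => ?_) (fun j hj => ?_)
  · positivity
  · have hn1 : (0 : ℝ) ≤ (n : ℝ) + j - 1 := by
      have : ((j : ℝ) + 1) ≤ n := by exact_mod_cast hj
      linarith [(by positivity : (0 : ℝ) ≤ j)]
    positivity

/-- The multiplier `∏_{j<n} (a+jc)/(a+b+(n+j-1)c)` of the recurrence is positive for
`a, b > 0`, `c ≥ 0`. [folklore] -/
theorem multiplier_pos (n : ℕ) {a b c : ℝ} (ha : 0 < a) (hb : 0 < b) (hc : 0 ≤ c) :
    0 < ∏ j ∈ range n, (a + j * c) / (a + b + ((n : ℝ) + j - 1) * c) := by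
  refine prod_pos fun j hj => ?_
  rw [Finset.mem_range] at hj
  have hn1 : (0 : ℝ) ≤ (n : ℝ) + j - 1 := by
    have : ((j : ℝ) + 1) ≤ n := by exact_mod_cast hj
    linarith [(by positivity : (0 : ℝ) ≤ j)]
  positivity

/-! ### Continuity of Gamma at positive arguments -/

/-- `x ↦ Γ(x + k)` is continuous at any `x` with `x + k > 0`. [folklore] -/
theorem continuousAt_Gamma_add {x k : ℝ} (h : 0 < x + k) :
    ContinuousAt (fun a : ℝ => Gamma (a + k)) x := by
  have hG : ContinuousAt Gamma (x + k) := by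
    refine (differentiableAt_Gamma fun m => ?_).continuousAt
    have : (0 : ℝ) ≤ m := by positivity
    intro hx; linarith
  have h2 : ContinuousAt (fun a : ℝ => a + k) x := by fun_prop
  exact hG.comp_of_eq h2 rfl

/-! ### Selberg's normalisation: the limit `a → 0⁺` -/

/-- **Selberg's normalisation identity** (product side of the `n ↦ n+1` induction): for
`b, c > 0`, `a · selbergProduct (m+1) a b c → (m+1) · selbergProduct m (2c) b c` as `a → 0⁺`.
This is the Gamma-function counterpart of `a Sₘ₊₁(a,b,c) → (m+1) Sₘ(2c,b,c)`.
[cite: ForresterWarnaar2008, eq. (1.1)] -/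
theorem tendsto_mul_selbergProduct_succ (m : ℕ) {b c : ℝ} (hb : 0 < b) (hc : 0 < c) :
    Tendsto (fun a => a * selbergProduct (m + 1) a b c) (𝓝[>] 0)
      (𝓝 ((m + 1) * selbergProduct m (2 * c) b c)) := by
  -- the factors of the product, as functions of `a`
  set F : ℕ → ℝ → ℝ := fun j a =>
    Gamma (a + j * c) * Gamma (b + j * c) * Gamma (1 + (j + 1) * c) /
      (Gamma (a + b + ((m : ℝ) + j) * c) * Gamma (1 + c)) with hF
  have hP : ∀ a, selbergProduct (m + 1) a b c = ∏ j ∈ range (m + 1), F j a := by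
    intro a
    unfold selbergProduct
    refine prod_congr rfl fun j _ => ?_
    simp only [hF]
    push_cast
    ring_nf
  -- the regularised function `R a = Γ(a+1) · (rest)`, continuous at `a = 0`
  set R : ℝ → ℝ := fun a =>
    Gamma (a + 1) * Gamma b * Gamma (1 + c) / (Gamma (a + b + (m : ℝ) * c) * Gamma (1 + c)) *
      ∏ j ∈ range m, F (j + 1) a with hR
  have hF0 : ∀ a, F 0 a = Gamma a * Gamma b * Gamma (1 + c) /
      (Gamma (a + b + (m : ℝ) * c) * Gamma (1 + c)) := by
    intro a
    simp [hF]
  have hRP : ∀ a : ℝ, 0 < a → a * selbergProduct (m + 1) a b c = R a := by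
    intro a ha
    rw [hP, prod_range_succ', hF0]
    simp only [hR]
    rw [Gamma_add_one ha.ne']
    ring
  -- continuity of `R` at `0`
  have hb' : ∀ k : ℝ, 0 ≤ k → 0 < b + k * c := fun k hk => by positivity
  have hRcont : ContinuousAt R 0 := by
    simp only [hR, hF]
    refine ContinuousAt.mul ?_ ?_
    · refine ContinuousAt.div ?_ ?_ ?_
      · refine ContinuousAt.mul (ContinuousAt.mul ?_ continuousAt_const) continuousAt_const
        exact continuousAt_Gamma_add (by norm_num)
      · refine ContinuousAt.mul ?_ continuousAt_const
        have := continuousAt_Gamma_add (x := 0) (k := b + (m : ℝ) * c)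
          (by have := hb' m (by positivity); linarith)
        refine this.congr (Eventually.of_forall fun a => ?_)
        simp only; ring_nf
      · refine mul_ne_zero (Gamma_pos_of_pos ?_).ne' (Gamma_pos_of_pos (by linarith)).ne'
        have := hb' m (by positivity); linarith
    · refine tendsto_finsetProd _ fun j _ => ?_
      refine ContinuousAt.div ?_ ?_ ?_
      · refine ContinuousAt.mul (ContinuousAt.mul ?_ continuousAt_const) continuousAt_const
        push_cast
        exact continuousAt_Gamma_add (by positivity)
      · refine ContinuousAt.mul ?_ continuousAt_const
        push_cast
        have := continuousAt_Gamma_add (x := 0) (k := b + ((m : ℝ) + (j + 1)) * c)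
          (by have := hb' ((m : ℝ) + (j + 1)) (by positivity); linarith)
        refine this.congr (Eventually.of_forall fun a => ?_)
        simp only; ring_nf
      · push_cast
        refine mul_ne_zero (Gamma_pos_of_pos ?_).ne' (Gamma_pos_of_pos (by linarith)).ne'
        have := hb' ((m : ℝ) + (j + 1)) (by positivity); linarith
  -- the value `R 0 = (m+1) · selbergProduct m (2c) b c`
  have hR0 : R 0 = (m + 1) * selbergProduct m (2 * c) b c := by
    -- the families of Gamma factors
    set A : ℕ → ℝ := fun k => Gamma (k * c) with hA
    set B : ℕ → ℝ := fun k => Gamma (b + k * c) with hB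
    set C : ℕ → ℝ := fun k => Gamma (1 + k * c) with hC
    set D : ℕ → ℝ := fun j => Gamma (b + ((m : ℝ) + j + 1) * c) * Gamma (1 + c) with hD
    have hG1c : Gamma (1 + c) ≠ 0 := (Gamma_pos_of_pos (by linarith)).ne'
    have hBm_ne : B m ≠ 0 := by
      simp only [hB]; exact (Gamma_pos_of_pos (hb' m (by positivity))).ne'
    have hApos : ∀ k : ℕ, 0 < A (k + 1) := fun k => by
      simp only [hA]; push_cast; exact Gamma_pos_of_pos (by positivity)
    have hRdef : R 0 = Gamma (0 + 1) * Gamma b * Gamma (1 + c) /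
        (Gamma (0 + b + (m : ℝ) * c) * Gamma (1 + c)) * ∏ j ∈ range m, F (j + 1) 0 := rfl
    have hpre : Gamma (0 + 1) * Gamma b * Gamma (1 + c) /
        (Gamma (0 + b + (m : ℝ) * c) * Gamma (1 + c)) = Gamma b / B m := by
      simp only [hB, zero_add, Gamma_one, one_mul]
      field_simp
    have hlhs : ∏ j ∈ range m, F (j + 1) 0 =
        (∏ j ∈ range m, A (j + 1)) * (∏ j ∈ range m, B (j + 1)) *
          (∏ j ∈ range m, C (j + 2)) / ∏ j ∈ range m, D j := by
      rw [← prod_mul_distrib, ← prod_mul_distrib, ← prod_div_distrib]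
      refine prod_congr rfl fun j _ => ?_
      simp only [hF, hA, hB, hC, hD]
      push_cast
      ring_nf
    have hrhs : selbergProduct m (2 * c) b c =
        (∏ j ∈ range m, A (j + 2)) * (∏ j ∈ range m, B j) *
          (∏ j ∈ range m, C (j + 1)) / ∏ j ∈ range m, D j := by
      unfold selbergProduct
      rw [← prod_mul_distrib, ← prod_mul_distrib, ← prod_div_distrib]
      refine prod_congr rfl fun j _ => ?_
      simp only [hA, hB, hC, hD]
      push_cast
      ring_nf
    -- index shifts
    have hBs : Gamma b * ∏ j ∈ range m, B (j + 1) = (∏ j ∈ range m, B j) * B m := by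
      have h : ∏ j ∈ range (m + 1), B j = (∏ j ∈ range m, B (j + 1)) * B 0 :=
        prod_range_succ' B m
      have h' : ∏ j ∈ range (m + 1), B j = (∏ j ∈ range m, B j) * B m := prod_range_succ B m
      have hB0 : B 0 = Gamma b := by simp [hB]
      rw [hB0] at h
      rw [mul_comm (Gamma b), ← h, h']
    have hAs : (∏ j ∈ range m, A (j + 1)) * A (m + 1) = A 1 * ∏ j ∈ range m, A (j + 2) := by
      have h : ∏ j ∈ range (m + 1), A (j + 1) = (∏ j ∈ range m, A (j + 2)) * A 1 :=
        prod_range_succ' (fun j => A (j + 1)) m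
      have h' : ∏ j ∈ range (m + 1), A (j + 1) = (∏ j ∈ range m, A (j + 1)) * A (m + 1) :=
        prod_range_succ (fun j => A (j + 1)) m
      rw [← h', h, mul_comm]
    have hCs : (∏ j ∈ range m, C (j + 2)) * C 1 = (∏ j ∈ range m, C (j + 1)) * C (m + 1) := by
      have h : ∏ j ∈ range (m + 1), C (j + 1) = (∏ j ∈ range m, C (j + 2)) * C 1 :=
        prod_range_succ' (fun j => C (j + 1)) m
      have h' : ∏ j ∈ range (m + 1), C (j + 1) = (∏ j ∈ range m, C (j + 1)) * C (m + 1) :=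
        prod_range_succ (fun j => C (j + 1)) m
      rw [← h, h']
    have hCm : C (m + 1) = (m + 1) * c * A (m + 1) := by
      simp only [hC, hA]; push_cast
      rw [add_comm (1 : ℝ), Gamma_add_one (by positivity)]
    have hC1 : C 1 = c * A 1 := by
      simp only [hC, hA]; push_cast
      rw [add_comm (1 : ℝ), one_mul, Gamma_add_one hc.ne']
    -- main computation
    have key : (∏ j ∈ range m, A (j + 1)) * ∏ j ∈ range m, C (j + 2) =
        (m + 1) * ((∏ j ∈ range m, A (j + 2)) * ∏ j ∈ range m, C (j + 1)) := by
      have hne : A (m + 1) * C 1 ≠ 0 :=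
        mul_ne_zero (hApos m).ne' (by rw [hC1]; exact mul_ne_zero hc.ne' (hApos 0).ne')
      refine mul_right_cancel₀ hne ?_
      calc (∏ j ∈ range m, A (j + 1)) * (∏ j ∈ range m, C (j + 2)) * (A (m + 1) * C 1)
          = ((∏ j ∈ range m, A (j + 1)) * A (m + 1)) * ((∏ j ∈ range m, C (j + 2)) * C 1) := by
            ring
        _ = (A 1 * ∏ j ∈ range m, A (j + 2)) * ((∏ j ∈ range m, C (j + 1)) * C (m + 1)) := by
            rw [hAs, hCs]
        _ = (A 1 * ∏ j ∈ range m, A (j + 2)) *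
              ((∏ j ∈ range m, C (j + 1)) * ((m + 1) * c * A (m + 1))) := by rw [hCm]
        _ = (m + 1) * ((∏ j ∈ range m, A (j + 2)) * ∏ j ∈ range m, C (j + 1)) *
              (A (m + 1) * (c * A 1)) := by ring
        _ = (m + 1) * ((∏ j ∈ range m, A (j + 2)) * ∏ j ∈ range m, C (j + 1)) *
              (A (m + 1) * C 1) := by rw [← hC1]
    rw [hRdef, hpre, hlhs, hrhs]
    set PA1 := ∏ j ∈ range m, A (j + 1) with hPA1
    set PA2 := ∏ j ∈ range m, A (j + 2) with hPA2
    set PB0 := ∏ j ∈ range m, B j with hPB0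
    set PB1 := ∏ j ∈ range m, B (j + 1) with hPB1
    set PC1 := ∏ j ∈ range m, C (j + 1) with hPC1
    set PC2 := ∏ j ∈ range m, C (j + 2) with hPC2
    set PD := ∏ j ∈ range m, D j with hPD
    calc Gamma b / B m * (PA1 * PB1 * PC2 / PD)
        = (Gamma b * PB1) * (PA1 * PC2) / B m / PD := by ring
      _ = (PB0 * B m) * ((m + 1) * (PA2 * PC1)) / B m / PD := by rw [hBs, key]
      _ = (m + 1) * (PA2 * PB0 * PC1 / PD) := by
            field_simp
  -- conclusion
  have hlim : Tendsto R (𝓝[>] 0) (𝓝 ((m + 1) * selbergProduct m (2 * c) b c)) := by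
    rw [← hR0]
    exact hRcont.tendsto.mono_left nhdsWithin_le_nhds
  refine hlim.congr' ?_
  filter_upwards [self_mem_nhdsWithin] with a ha
  exact (hRP a ha).symm

end Selberg

end Literature.Analysis.SpecialFunctions

end
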